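import Summits.QuantumFields.BalabanUV.T4Continuum.Support.NE3CovariantLineSumsL2
import HarnessLib

/-!
# T⁴ programme, node NE3, row E-MLw-(w4)-P · C1 (file 5) — THE k-LEVEL ERROR IN THE ℓ²(TORUS) CURRENCY:
# `√l2sq_N (ErrIter L (j+1) W Y) ≤ 2·S2sum·ρ^j·√l2sq_{L^{j+1}N} Y`, `ρ = √(L²∕L^d)`, under the explicit smallness `S2sum ≤ ρ∕2` (k-, N-, M-FREE)

NE3 formalisation swarm `b2b-balaban-t4-ne3-formalise-*`, LEAF PROVER 04 (gen 4), row **C1** (owner cuts D-ne3p1-g21-1 §4 ∕ D-ne3p1-g21-2 §2), file 5 after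
`NE3CovariantLineSumsL2` (one level in ℓ²: exact weight `L²∕L^d` for `Qstr`, box-counting constant `C2sq` for `Dstr`, Minkowski).  The induction of
`NE3CovariantLineSumsError.norm_ErrIter_le` with the sup replaced by the torus ℓ² norm, the growth factor `L` by `ρ = √(L²∕L^d)` and the triangle
inequality by Minkowski.  THIS is the currency the assembly of (P_W) on the frame-free slice needs: with `S_W = E = −ErrIter` (Φ5-tangency,
`NE3FrameFreeTangency`), the S-term `4·((L^k)^d∕(L^k)²)·l2sq_N (S_W)` of `NE3BlockPoincareLocal.sum_norm_sq_le_stable` is `≤ 16·S2sum²·(L^d∕L²)·l2sq Y`, absorbable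
for `S2sum` small (an explicit smallness of the top-level radius, stronger than `LevelSmall` by a k-free constant — stated as a hypothesis, never hidden).

CONTENT (all [folklore]; 0 sorry; DATA defs `rho`, `delta2`, `S2sum` (explicit reals ∕ structural recursion) → async audit):
§1 periodicity of the one-level objects on the coarse lattice: `segMain_add_period`, `Qstr_add_period`, `Dstr_add_period`;
§2 `rho d L = √(L²∕L^d)`, `delta2 d L x = 16(d+1)(d+4)L²x·√C2sq`, `S2sum (j+1) x = delta2 x + S2sum j (prop1Radius x)`; square-rooted one-level bounds
   `sqrt_l2sq_Qstr_le` (`≤ ρ·√l2sq Y`), `sqrt_l2sq_Dstr_le` (`≤ delta2·√l2sq Y`); `sqrt_l2sq_QstrIter_le` (`≤ ρ^{j+1}·√l2sq Y`);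
§3 **`sqrt_l2sq_ErrIter_le`** — in the multi-level small-field class with `W`, `Y` of period `tower L N (j+1)` and `S2sum d L (j+1) x ≤ ρ∕2`:
   `√l2sq_{periodBox N} (ErrIter L (j+1) W Y) ≤ 2·S2sum d L (j+1) x·ρ^j·√l2sq_{periodBox (tower L N (j+1))} Y`.

HONEST: covariant kinematics on OUR frame; constants crude (box counting) but k-, N-, M-free; nothing about minimisers, (P_W), (ML_w), T-E_w or NE3
is asserted; NE3 NOT proved; spine 0∕9; finite T⁴ rung (B)+1 — NOT infinite volume, NOT mass gap, NOT BetaPertH, NOT Clay.  PLACEMENT: `Summits/QuantumFields/BalabanUV/`.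
-/

set_option autoImplicit false

open scoped BigOperators Matrix.Norms.L2Operator
open Finset

namespace Summit.QuantumFields.BalabanUV.T4Continuum.NE3CovariantLineSumsL2Tower

open Literature.MathematicalPhysics.QuantumFieldTheory.Balaban1983to89
open B7Prop1Explicit B7Prop2Explicit
open T4AveragingDeficitWall (IsUnitaryCfg IsSkewDir SmallField Ad)
open T4AveragingDeficitWallBoundary (IsPeriodicCfg periodBox)
open T4AveragingDeficitNonAbelian (hol_add_period)
open AveragingDeficitPeriodicCounting (IsPeriodicDir)
open AveragingDeficitTransport (dhol)
open AveragingDeficitLiftPeriodic (shiftDir dhol_shift bavg_shift hol_shift)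
open AveragingDeficitChartCalculus (cavg)
open AveragingDeficitFermat (isPeriodicCfg_cavg)
open AveragingDeficitMultiLevelPrep (cavgIter tower LevelSmall natCast_tower_succ prop1Radius_nonneg)
open AveragingDeficitTwoLevelPrep (prop1Radius)
open BlockAverageDbarLinBound (segMain)
open NE3TangentCovariantStructure (Qbar Qbar_add_period)
open NE3TangentCovariantTower (QbarIter step_small)
open NE3CovariantLineSums (Qstr)
open NE3CovariantLineSumsTower (Dstr QstrIter ErrIter QstrIter_succ QstrIter_zero ErrIter_succ ErrIter_zero QbarIter_eq_QstrIter_add_ErrIter)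
open NE3CovariantLineSumsL2 (l2sq l2sq_nonneg sqrt_l2sq_add_le l2sq_Qstr_le l2sq_Dstr_le C2sq)

noncomputable section

variable {d : ℕ} {n : Type*} [Fintype n] [DecidableEq n]

/-! ## §1 Periodicity of the one-level objects on the coarse lattice -/

/-- The transported straight segments of periodic data are periodic. [folklore] -/
theorem segMain_add_period (L : ℕ) {W : Site d → Fin d → (Matrix n n ℂ)ˣ} {Y : Site d → Fin d → Matrix n n ℂ} {t : Site d}
    (hW : ∀ (x : Site d) (μ : Fin d), W (x + t) μ = W x μ) (hY : ∀ (x : Site d) (μ : Fin d), Y (x + t) μ = Y x μ)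
    (q : Site d) (κ : Fin d) : segMain L W Y (q + t) κ = segMain L W Y q κ := by
  have hshift : shiftDir t Y = Y := by
    funext x μ
    have := hY (x - t) μ
    rw [sub_add_cancel] at this
    simpa [shiftDir] using this.symm
  unfold segMain
  refine Finset.sum_congr rfl fun r _ => ?_
  rw [hol_shift (W := W) (W' := W) hW, add_right_comm]
  have h := dhol_shift hW Y (seg κ L) (q + boxVec L r)
  rw [hshift] at h
  rw [h]

/-- `Qstr` of `(L·P)`-periodic data is `P`-periodic on the coarse lattice. [folklore] -/
theorem Qstr_add_period (L : ℕ) {W : Site d → Fin d → (Matrix n n ℂ)ˣ} {Y : Site d → Fin d → Matrix n n ℂ} {P : ℤ}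
    (hW : IsPeriodicCfg W ((L : ℤ) * P)) (hY : IsPeriodicDir Y ((L : ℤ) * P)) (z : Site d) (i κ : Fin d) :
    Qstr L W Y (z + P • e i) κ = Qstr L W Y z κ := by
  have hWt : ∀ (x : Site d) (μ : Fin d), W (x + ((L : ℤ) * P) • e i) μ = W x μ := fun x μ => hW x i μ
  have hYt : ∀ (x : Site d) (μ : Fin d), Y (x + ((L : ℤ) * P) • e i) μ = Y x μ := fun x μ => hY x i μ
  have e1 : (L : ℤ) • (z + P • e i) = (L : ℤ) • z + ((L : ℤ) * P) • e i := by rw [smul_add, smul_smul]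
  simp only [Qstr, e1]
  rw [bavg_shift L hWt, segMain_add_period L hWt hYt]

/-- `Dstr` of `(L·P)`-periodic data is `P`-periodic on the coarse lattice. [folklore] -/
theorem Dstr_add_period (L : ℕ) {W : Site d → Fin d → (Matrix n n ℂ)ˣ} {Y : Site d → Fin d → Matrix n n ℂ} {P : ℤ}
    (hW : IsPeriodicCfg W ((L : ℤ) * P)) (hY : IsPeriodicDir Y ((L : ℤ) * P)) (z : Site d) (i κ : Fin d) :
    Dstr L W Y (z + P • e i) κ = Dstr L W Y z κ := by
  simp only [Dstr, Qbar_add_period L hW hY, Qstr_add_period L hW hY]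

/-! ## §2 Constants, square-rooted one-level bounds, the straight tower in ℓ² -/

/-- The ℓ² contraction factor of one straight average: `ρ = √(L²∕L^d)`. [folklore] -/
def rho (d L : ℕ) : ℝ := Real.sqrt ((L : ℝ) ^ 2 / (L : ℝ) ^ d)

/-- The one-level ℓ² relative defect at radius `x`: `delta2 d L x = 16(d+1)(d+4)L²x·√(C2sq d L)`. [folklore] -/
def delta2 (d L : ℕ) (x : ℝ) : ℝ := (16 * (d + 1) * (d + 4) * (L : ℝ) ^ 2 * x) * Real.sqrt (C2sq d L)

/-- THE LEVEL SUM of the ℓ² relative defects (inner-first): `S2sum 0 x = 0`, `S2sum (j+1) x = delta2 x + S2sum j (prop1Radius x)`. [folklore] -/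
def S2sum (d L : ℕ) : ℕ → ℝ → ℝ
  | 0, _ => 0
  | j + 1, x => delta2 d L x + S2sum d L j (prop1Radius d L x)

omit [Fintype n] [DecidableEq n] in
/-- `0 ≤ ρ`. [folklore] -/
theorem rho_nonneg (d L : ℕ) : 0 ≤ rho d L := Real.sqrt_nonneg _

omit [Fintype n] [DecidableEq n] in
/-- `0 ≤ delta2 x` for `x ≥ 0`. [folklore] -/
theorem delta2_nonneg (d L : ℕ) {x : ℝ} (hx : 0 ≤ x) : 0 ≤ delta2 d L x := by
  unfold delta2; have := Real.sqrt_nonneg (C2sq d L); positivity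

omit [Fintype n] [DecidableEq n] in
/-- `0 ≤ S2sum j x` for `x ≥ 0`. [folklore] -/
theorem S2sum_nonneg (d L : ℕ) : ∀ (j : ℕ) {x : ℝ}, 0 ≤ x → 0 ≤ S2sum d L j x
  | 0, _, _ => le_rfl
  | j + 1, _, hx => add_nonneg (delta2_nonneg d L hx) (S2sum_nonneg d L j (prop1Radius_nonneg hx))

omit [Fintype n] [DecidableEq n] in
/-- `S2sum (j+1) x = delta2 x + S2sum j (prop1Radius x)`. [folklore] -/
theorem S2sum_succ (d L j : ℕ) (x : ℝ) : S2sum d L (j + 1) x = delta2 d L x + S2sum d L j (prop1Radius d L x) := rfl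

/-- `√l2sq_{N′} (Qstr L W Y) ≤ ρ·√l2sq_{L·N′} Y`. [folklore] -/
theorem sqrt_l2sq_Qstr_le [Nonempty n] {L : ℕ} (hL : 1 ≤ L) {N' : ℕ} (hN' : 1 ≤ N') {W : Site d → Fin d → (Matrix n n ℂ)ˣ}
    (hWu : IsUnitaryCfg W) {a : ℝ} (ha : 0 ≤ a) (hsmall : 512 * (d + 1) * (d + 4) * (L : ℝ) ^ 2 * a ≤ 1) (hWa : SmallField W a)
    {Y : Site d → Fin d → Matrix n n ℂ} (hY : IsPeriodicDir Y ((L * N' : ℕ) : ℤ)) :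
    Real.sqrt (l2sq (periodBox (d := d) N') (Qstr L W Y)) ≤ rho d L * Real.sqrt (l2sq (periodBox (d := d) (L * N')) Y) := by
  have h := l2sq_Qstr_le hL hN' hWu ha hsmall hWa hY
  unfold rho
  rw [← Real.sqrt_mul (by positivity)]
  exact Real.sqrt_le_sqrt h

/-- `√l2sq_{N′} (Dstr L W Y) ≤ delta2·√l2sq_{L·N′} Y`. [folklore] -/
theorem sqrt_l2sq_Dstr_le [Nonempty n] {L : ℕ} (hL : 1 ≤ L) {N' : ℕ} (hN' : 1 ≤ N') {W : Site d → Fin d → (Matrix n n ℂ)ˣ}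
    (hWu : IsUnitaryCfg W) {a : ℝ} (ha : 0 ≤ a) (hsmall : 512 * (d + 1) * (d + 4) * (L : ℝ) ^ 2 * a ≤ 1) (hWa : SmallField W a)
    {Y : Site d → Fin d → Matrix n n ℂ} (hY : IsPeriodicDir Y ((L * N' : ℕ) : ℤ)) :
    Real.sqrt (l2sq (periodBox (d := d) N') (Dstr L W Y)) ≤ delta2 d L a * Real.sqrt (l2sq (periodBox (d := d) (L * N')) Y) := by
  have h := l2sq_Dstr_le hL hN' hWu ha hsmall hWa hY
  have hw0 : 0 ≤ 16 * (d + 1) * (d + 4) * (L : ℝ) ^ 2 * a := by positivity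
  have hC0 : 0 ≤ C2sq d L := by unfold C2sq; positivity
  unfold delta2
  calc Real.sqrt (l2sq (periodBox (d := d) N') (Dstr L W Y))
      ≤ Real.sqrt ((16 * (d + 1) * (d + 4) * (L : ℝ) ^ 2 * a) ^ 2 * C2sq d L * l2sq (periodBox (d := d) (L * N')) Y) :=
        Real.sqrt_le_sqrt h
    _ = (16 * (d + 1) * (d + 4) * (L : ℝ) ^ 2 * a) * Real.sqrt (C2sq d L) * Real.sqrt (l2sq (periodBox (d := d) (L * N')) Y) := by
        rw [Real.sqrt_mul (by positivity), Real.sqrt_mul (by positivity), Real.sqrt_sq hw0]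

/-- Periodicity bookkeeping for the tower: `W`, `Y` of period `tower L N (j+1) = L·tower L N j`. [folklore] -/
theorem periodic_step {L N j : ℕ} {W : Site d → Fin d → (Matrix n n ℂ)ˣ} {Y : Site d → Fin d → Matrix n n ℂ}
    (hWP : IsPeriodicCfg W ((tower L N (j + 1) : ℕ) : ℤ)) (hYP : IsPeriodicDir Y ((tower L N (j + 1) : ℕ) : ℤ)) :
    IsPeriodicCfg W ((L : ℤ) * (tower L N j : ℕ)) ∧ IsPeriodicDir Y ((L : ℤ) * (tower L N j : ℕ))
      ∧ IsPeriodicDir Y ((L * tower L N j : ℕ) : ℤ)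
      ∧ IsPeriodicCfg (cavg L W) ((tower L N j : ℕ) : ℤ)
      ∧ IsPeriodicDir (Qstr L W Y) ((tower L N j : ℕ) : ℤ) ∧ IsPeriodicDir (Dstr L W Y) ((tower L N j : ℕ) : ℤ) := by
  have hWP' : IsPeriodicCfg W ((L : ℤ) * (tower L N j : ℕ)) := by rw [← natCast_tower_succ]; exact hWP
  have hYP' : IsPeriodicDir Y ((L : ℤ) * (tower L N j : ℕ)) := by rw [← natCast_tower_succ]; exact hYP
  have hYP'' : IsPeriodicDir Y ((L * tower L N j : ℕ) : ℤ) := by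
    have e : ((L * tower L N j : ℕ) : ℤ) = (L : ℤ) * (tower L N j : ℕ) := by push_cast; ring
    rw [e]; exact hYP'
  exact ⟨hWP', hYP', hYP'', isPeriodicCfg_cavg L _ hWP', fun z i κ => Qstr_add_period L hWP' hYP' z i κ,
    fun z i κ => Dstr_add_period L hWP' hYP' z i κ⟩

/-- **THE STRAIGHT TOWER IN ℓ²**: `√l2sq_N (QstrIter L (j+1) W Y) ≤ ρ^{j+1}·√l2sq_{tower L N (j+1)} Y` in the multi-level small-field class. [folklore] -/
theorem sqrt_l2sq_QstrIter_le [Nonempty n] {L N : ℕ} (hL : 1 ≤ L) (hN : 1 ≤ N) (j : ℕ) :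
    ∀ {W : Site d → Fin d → (Matrix n n ℂ)ˣ} {x : ℝ}, IsUnitaryCfg W → IsPeriodicCfg W ((tower L N (j + 1) : ℕ) : ℤ) → 0 ≤ x →
    LevelSmall d L j x → SmallField W x → ∀ {Y : Site d → Fin d → Matrix n n ℂ}, IsPeriodicDir Y ((tower L N (j + 1) : ℕ) : ℤ) →
      Real.sqrt (l2sq (periodBox (d := d) N) (QstrIter L (j + 1) W Y))
        ≤ rho d L ^ (j + 1) * Real.sqrt (l2sq (periodBox (d := d) (tower L N (j + 1))) Y) := by
  induction j with
  | zero =>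
      intro W x hWu hWP hx hsm hWx Y hYP
      obtain ⟨h512, -, -, -⟩ := step_small hL hWu hx hsm hWx
      obtain ⟨-, -, hYP'', -, -, -⟩ := periodic_step (d := d) hWP hYP
      rw [zero_add, pow_one, QstrIter_succ, QstrIter_zero]
      have hN1 : (tower L N 0 : ℕ) = N := rfl
      have h := sqrt_l2sq_Qstr_le hL hN hWu hx h512 hWx (N' := N) (by simpa [tower] using hYP'')
      simpa [tower] using h
  | succ j ih =>
      intro W x hWu hWP hx hsm hWx Y hYP
      obtain ⟨h512, hW₁u, hr0, hW₁x⟩ := step_small hL hWu hx hsm.1 hWx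
      obtain ⟨-, -, hYP'', hW₁P, hQP, -⟩ := periodic_step (d := d) hWP hYP
      rw [QstrIter_succ]
      have hT1 : 1 ≤ tower L N (j + 1) := Nat.one_le_iff_ne_zero.mpr (by
        haveI : NeZero L := ⟨by omega⟩; haveI : NeZero N := ⟨by omega⟩
        exact AveragingDeficitMultiLevelPrep.tower_ne_zero L N (j + 1))
      have h1 := ih hW₁u hW₁P hr0 hsm.2 hW₁x hQP
      have h2 := sqrt_l2sq_Qstr_le hL hT1 hWu hx h512 hWx (N' := tower L N (j + 1)) hYP''
      have hρ := rho_nonneg d L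
      calc Real.sqrt (l2sq (periodBox (d := d) N) (QstrIter L (j + 1) (cavg L W) (Qstr L W Y)))
          ≤ rho d L ^ (j + 1) * Real.sqrt (l2sq (periodBox (d := d) (tower L N (j + 1))) (Qstr L W Y)) := h1
        _ ≤ rho d L ^ (j + 1) * (rho d L * Real.sqrt (l2sq (periodBox (d := d) (L * tower L N (j + 1))) Y)) :=
            mul_le_mul_of_nonneg_left h2 (by positivity)
        _ = rho d L ^ (j + 1 + 1) * Real.sqrt (l2sq (periodBox (d := d) (tower L N (j + 1 + 1))) Y) := by
            rw [show (tower L N (j + 1 + 1)) = L * tower L N (j + 1) from rfl]; ring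

/-! ## §3 The accumulated error in ℓ² -/

/-- **THE k-LEVEL ERROR IN THE ℓ²(TORUS) CURRENCY**: in the multi-level small-field class, for `W`, `Y` of period `tower L N (j+1)` and the level
sum `S2sum d L (j+1) x ≤ ρ∕2`:
`√l2sq_{periodBox N} (ErrIter L (j+1) W Y) ≤ 2·S2sum d L (j+1) x·ρ^j·√l2sq_{periodBox (tower L N (j+1))} Y`. [folklore] -/
theorem sqrt_l2sq_ErrIter_le [Nonempty n] {L N : ℕ} (hL : 1 ≤ L) (hN : 1 ≤ N) (j : ℕ) :
    ∀ {W : Site d → Fin d → (Matrix n n ℂ)ˣ} {x : ℝ}, IsUnitaryCfg W → IsPeriodicCfg W ((tower L N (j + 1) : ℕ) : ℤ) → 0 ≤ x →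
    LevelSmall d L j x → SmallField W x → S2sum d L (j + 1) x ≤ rho d L / 2 →
    ∀ {Y : Site d → Fin d → Matrix n n ℂ}, IsPeriodicDir Y ((tower L N (j + 1) : ℕ) : ℤ) →
      Real.sqrt (l2sq (periodBox (d := d) N) (ErrIter L (j + 1) W Y))
        ≤ 2 * S2sum d L (j + 1) x * rho d L ^ j * Real.sqrt (l2sq (periodBox (d := d) (tower L N (j + 1))) Y) := by
  induction j with
  | zero =>
      intro W x hWu hWP hx hsm hWx _ Y hYP
      obtain ⟨h512, -, -, -⟩ := step_small hL hWu hx hsm hWx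
      obtain ⟨-, -, hYP'', -, -, -⟩ := periodic_step (d := d) hWP hYP
      have hE : ErrIter L (0 + 1) W Y = Dstr L W Y := by
        rw [zero_add, ErrIter_succ]; funext z κ; simp [ErrIter_zero, NE3TangentCovariantTower.QbarIter_zero]
      rw [hE]
      have h := sqrt_l2sq_Dstr_le hL hN hWu hx h512 hWx (N' := N) (by simpa [tower] using hYP'')
      have hS : S2sum d L (0 + 1) x = delta2 d L x := by rw [zero_add, S2sum_succ]; simp [S2sum]
      rw [hS, pow_zero, mul_one]
      have hδ := delta2_nonneg d L hx
      have hq : 0 ≤ Real.sqrt (l2sq (periodBox (d := d) (tower L N (0 + 1))) Y) := Real.sqrt_nonneg _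
      have h' : Real.sqrt (l2sq (periodBox (d := d) N) (Dstr L W Y))
          ≤ delta2 d L x * Real.sqrt (l2sq (periodBox (d := d) (tower L N (0 + 1))) Y) := by simpa [tower] using h
      nlinarith [mul_nonneg hδ hq]
  | succ j ih =>
      intro W x hWu hWP hx hsm hWx hS Y hYP
      obtain ⟨h512, hW₁u, hr0, hW₁x⟩ := step_small hL hWu hx hsm.1 hWx
      obtain ⟨-, -, hYP'', hW₁P, hQP, hDP⟩ := periodic_step (d := d) hWP hYP
      have hT1 : 1 ≤ tower L N (j + 1) := Nat.one_le_iff_ne_zero.mpr (by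
        haveI : NeZero L := ⟨by omega⟩; haveI : NeZero N := ⟨by omega⟩
        exact AveragingDeficitMultiLevelPrep.tower_ne_zero L N (j + 1))
      -- the level sum splits
      set S' : ℝ := S2sum d L (j + 1) (prop1Radius d L x) with hS'def
      have hSsplit : S2sum d L (j + 1 + 1) x = delta2 d L x + S' := S2sum_succ d L (j + 1) x
      have hδ0 : 0 ≤ delta2 d L x := delta2_nonneg d L hx
      have hS'0 : 0 ≤ S' := S2sum_nonneg d L (j + 1) hr0
      have hS'le : S' ≤ rho d L / 2 := by linarith
      have hρ := rho_nonneg d L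
      -- names for the norms
      set nY : ℝ := Real.sqrt (l2sq (periodBox (d := d) (tower L N (j + 1 + 1))) Y) with hnY
      have hnY0 : 0 ≤ nY := Real.sqrt_nonneg _
      -- one-level bounds at the base
      have hQ : Real.sqrt (l2sq (periodBox (d := d) (tower L N (j + 1))) (Qstr L W Y)) ≤ rho d L * nY :=
        sqrt_l2sq_Qstr_le hL hT1 hWu hx h512 hWx (N' := tower L N (j + 1)) hYP''
      have hD : Real.sqrt (l2sq (periodBox (d := d) (tower L N (j + 1))) (Dstr L W Y)) ≤ delta2 d L x * nY :=
        sqrt_l2sq_Dstr_le hL hT1 hWu hx h512 hWx (N' := tower L N (j + 1)) hYP''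
      -- first term: IH at W₁ on `Qstr W Y`
      have h1 := ih hW₁u hW₁P hr0 hsm.2 hW₁x hS'le hQP
      -- second term: `QbarIter = QstrIter + ErrIter` at W₁ on `Dstr W Y`, Minkowski
      have h2a := sqrt_l2sq_QstrIter_le hL hN j hW₁u hW₁P hr0 hsm.2 hW₁x hDP
      have h2b := ih hW₁u hW₁P hr0 hsm.2 hW₁x hS'le hDP
      have h2 : Real.sqrt (l2sq (periodBox (d := d) N) (QbarIter L (j + 1) (cavg L W) (Dstr L W Y)))
          ≤ rho d L ^ (j + 1) * (delta2 d L x * nY) + 2 * S' * rho d L ^ j * (delta2 d L x * nY) := by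
        rw [QbarIter_eq_QstrIter_add_ErrIter hL j hW₁u hr0 hsm.2 hW₁x (Dstr L W Y)]
        refine (sqrt_l2sq_add_le _ _ _).trans (add_le_add (h2a.trans ?_) (h2b.trans ?_))
        · exact mul_le_mul_of_nonneg_left hD (by positivity)
        · exact mul_le_mul_of_nonneg_left hD (by positivity)
      have h1' : Real.sqrt (l2sq (periodBox (d := d) N) (ErrIter L (j + 1) (cavg L W) (Qstr L W Y)))
          ≤ 2 * S' * rho d L ^ j * (rho d L * nY) := h1.trans (mul_le_mul_of_nonneg_left hQ (by positivity))
      rw [ErrIter_succ, hSsplit]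
      refine (sqrt_l2sq_add_le _ _ _).trans ((add_le_add h1' h2).trans ?_)
      -- `2S'ρ^j(ρ nY) + ρ^{j+1} δ nY + 2S'ρ^j δ nY ≤ 2(δ + S')ρ^{j+1} nY` iff `2S' ≤ ρ`
      have hρj : (0 : ℝ) ≤ rho d L ^ j := by positivity
      have key : 2 * S' * rho d L ^ j * (delta2 d L x * nY) ≤ rho d L ^ j * rho d L * (delta2 d L x * nY) := by
        have : 2 * S' ≤ rho d L := by linarith
        nlinarith [mul_nonneg hρj (mul_nonneg hδ0 hnY0)]
      have e : rho d L ^ (j + 1) = rho d L ^ j * rho d L := pow_succ _ _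
      rw [e]
      nlinarith [key, mul_nonneg hρj (mul_nonneg hδ0 hnY0), mul_nonneg hρj (mul_nonneg hρ hnY0), hS'0, hδ0]

end

end Summit.QuantumFields.BalabanUV.T4Continuum.NE3CovariantLineSumsL2Tower
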